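import Summits.BirchSwinnertonDyer.BirchSwinnertonDyer.Theorems.ManinLocalTwoThreePinningKernelFrickeMatrix
import Summits.BirchSwinnertonDyer.BirchSwinnertonDyer.Theorems.ManinLocalTwoThreePinningKernelStaged
import Summits.BirchSwinnertonDyer.BirchSwinnertonDyer.Theorems.ManinLocalTwoThreePinningNinetyTablesF
import Literature.NumberTheory.EllipticCurves.ModularFormsGamma0WeightTwoDimension
import HarnessLib

/-!
# Level 90 (genus 11) by the PINNING KERNEL: THE NEWFORM OF EVERY `X₀(90)`-DATUM IS `F_{90a, 90b, 90c}`, FACT-FREE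

Cell `bsd-f2-manin`, route `ManinLocalTwoThree`, crux C3 `ManinPrimeToThreeAtNine` (stmt-BirchSwinnertonDyer-22968), an g54 (LENS
analytic/periods); `--supports stmt-BirchSwinnertonDyer-22968` (helper).  INSTANCE of `…PinningKernel{Sieve,,Fricke}`: the level-63
template with the script-emitted data of level 90 (`an/g54/scripts/pk_data.py 90 54`, `emit_level.py 90 M`, `emit_levelfile.py`) and the
index data of `Γ₀(90)`; kernel certificates only, no level-specific algebra; the data and the table certificates are parts 1–2 (`…PinningNinetyTables`, `…PinningNinetyTablesB`), the `σ`-image certificates parts 3–4 (`…TablesE/F`); this file is part 5 (duals, staged sieve, matrix Fricke sieve of part E, dimension, pinning).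

THE RESULT.  `M₂(Γ₀(90))` (dimension `26 = g + ν_∞ − 1 = 11 + 16 − 1`) is spanned by 26 holomorphic `η`-quotients `C₀,…`
(`Ls`; NOT `σ`-closed — the `σ`-images `LsE` are certified as modular forms with tables and located in the basis by `coordsOK`, part E `…PinningKernelFrickeMat`), certified tables to depth `54`, integer duals (`d = 486000`).  The staged box sieve over
the primes `3, 2, 5, 7, 11, 13, 17, 19, 23, 29, 31` with the certified column relations leaves 4 prime assignment(s) (`certs`); the Fricke
sieve keeps `goodCerts` (Cremona `90a, 90b, 90c`; the others are old classes, killed for both signs by `decide`):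
**`pinning (D)`**: for some `(σ, d′, y) ∈ goodCerts`, `truth W = σ ∧ d′ • D.f = Σ_j y_j • C_j`, in `M₂(Γ₀(90))`, for every
`X₀(90)`-datum `D` of any elliptic `W/ℚ`.  HONEST FRAMING: unconditional, standard axioms; no newness/eigen statement about the
combination is proved; the Néron/`c`-side at `90` is NOT touched; nothing here proves C2/C3, Manin's conjecture or BSD.
[cite: CremonaAlgorithms1997, §2.10, Table 1 (90a, 90b, 90c)] [cite: AtkinLehner1970, Thm. 3] [cite: Koehler2011, §2.1, §2.4]
[cite: Ligozat1975, Ch. 3] [cite: DiamondShurman2005, Thm. 3.5.1]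
-/

set_option autoImplicit false
-- lint-debt: the directory name repeats the summit name (sibling precedent `ManinLocalTwoThreePinningSixtyThree.lean`)
set_option linter.dupNamespace false

noncomputable section


open Complex
open UpperHalfPlane hiding I
open scoped MatrixGroups ModularForm
open ModularForm CongruenceSubgroup
open Literature.NumberTheory.ModularForms
open Literature.NumberTheory.EllipticCurves Literature.NumberTheory.EllipticCurves.ModularForms

namespace Summit.BirchSwinnertonDyer.BirchSwinnertonDyer.Theorems.ManinLocalTwoThree.PinningNinety

open Summit.BirchSwinnertonDyer.BirchSwinnertonDyer.Theorems.ManinLocalTwoThree.BracketSturm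
open Summit.BirchSwinnertonDyer.BirchSwinnertonDyer.Theorems.ManinLocalTwoThree.PinningKernel


set_option maxHeartbeats 4000000
set_option maxRecDepth 16384

/-! ## §2e Duals, the staged sieve, the matrix Fricke data -/

/-- **The dual certificate** `⟨dualsᵢ, tabsⱼ⟩ = 486000·δᵢⱼ`. [folklore] -/
theorem hdual : ∀ i j : Fin 26, dotList (duals i) (tabs j) = if i = j then (486000 : ℤ) else 0 := by
  decide +kernel

/-- The dual vectors live below depth `32`. [folklore] -/
theorem hlen : ∀ i : Fin 26, (duals i).length ≤ 54 := by
  decide +kernel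

/-- **The relation certificate**: every stage relation is a column relation of the tables. [folklore] -/
theorem hrel : ∀ st ∈ stages, ∀ v ∈ st.2, v.length ≤ 54 ∧ ∀ j : Fin 26, dotList v (tabs j) = 0 := by
  decide +kernel

/-- Sieve stage `0`: the live list `L_0` is mapped into `L_1` (kernel `decide`). [folklore] -/
theorem hst0 : ∀ σ ∈ sieveStep 90 54 ((([[]] : List (List (ℕ × ℤ))) :: lvs).getD 0 []) (stages.getD 0 (0, [])), σ ∈ lvs.getD 0 [] := by decide +kernel
/-- Sieve stage `1`: the live list `L_1` is mapped into `L_2` (kernel `decide`). [folklore] -/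
theorem hst1 : ∀ σ ∈ sieveStep 90 54 ((([[]] : List (List (ℕ × ℤ))) :: lvs).getD 1 []) (stages.getD 1 (0, [])), σ ∈ lvs.getD 1 [] := by decide +kernel
/-- Sieve stage `2`: the live list `L_2` is mapped into `L_3` (kernel `decide`). [folklore] -/
theorem hst2 : ∀ σ ∈ sieveStep 90 54 ((([[]] : List (List (ℕ × ℤ))) :: lvs).getD 2 []) (stages.getD 2 (0, [])), σ ∈ lvs.getD 2 [] := by decide +kernel
/-- Stage 3 (`p = 7`, 27 live × box 11) is certified in 2 chunks. [folklore] -/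
def chunks3 : List (List (List (ℕ × ℤ))) :=
  [[[(3, 0), (2, -1), (5, -4)], [(3, 0), (2, -1), (5, -3)], [(3, 0), (2, -1), (5, -2)], [(3, 0), (2, -1), (5, -1)], [(3, 0), (2, -1), (5, 0)], [(3, 0), (2, -1), (5, 1)], [(3, 0), (2, -1), (5, 2)], [(3, 0), (2, -1), (5, 3)], [(3, 0), (2, -1), (5, 4)], [(3, 0), (2, 0), (5, -4)], [(3, 0), (2, 0), (5, -3)], [(3, 0), (2, 0), (5, -2)], [(3, 0), (2, 0), (5, -1)], [(3, 0), (2, 0), (5, 0)]],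
   [[(3, 0), (2, 0), (5, 1)], [(3, 0), (2, 0), (5, 2)], [(3, 0), (2, 0), (5, 3)], [(3, 0), (2, 0), (5, 4)], [(3, 0), (2, 1), (5, -4)], [(3, 0), (2, 1), (5, -3)], [(3, 0), (2, 1), (5, -2)], [(3, 0), (2, 1), (5, -1)], [(3, 0), (2, 1), (5, 0)], [(3, 0), (2, 1), (5, 1)], [(3, 0), (2, 1), (5, 2)], [(3, 0), (2, 1), (5, 3)], [(3, 0), (2, 1), (5, 4)]]]
/-- Sieve stage `3`, chunk `0` (kernel `decide`). [folklore] -/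
theorem hst3c0 : ∀ σ ∈ sieveStep 90 54 (chunks3.getD 0 []) (stages.getD 3 (0, [])), σ ∈ lvs.getD 3 [] := by decide +kernel
/-- Sieve stage `3`, chunk `1` (kernel `decide`). [folklore] -/
theorem hst3c1 : ∀ σ ∈ sieveStep 90 54 (chunks3.getD 1 []) (stages.getD 3 (0, [])), σ ∈ lvs.getD 3 [] := by decide +kernel
/-- Sieve stage `3`: the live list `L_3` is mapped into `L_4` (kernel `decide`). [folklore] -/
theorem hst3 : ∀ σ ∈ sieveStep 90 54 ((([[]] : List (List (ℕ × ℤ))) :: lvs).getD 3 []) (stages.getD 3 (0, [])), σ ∈ lvs.getD 3 [] :=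
  sieveStep_subset_of_chunks 90 54 chunks3 (by decide +kernel) fun j hj ↦ by
    have hj' : j < 2 := lt_of_lt_of_eq hj (by decide)
    interval_cases j
    exacts [hst3c0, hst3c1]
/-- Sieve stage `4`: the live list `L_4` is mapped into `L_5` (kernel `decide`). [folklore] -/
theorem hst4 : ∀ σ ∈ sieveStep 90 54 ((([[]] : List (List (ℕ × ℤ))) :: lvs).getD 4 []) (stages.getD 4 (0, [])), σ ∈ lvs.getD 4 [] := by decide +kernel
/-- Sieve stage `5`: the live list `L_5` is mapped into `L_6` (kernel `decide`). [folklore] -/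
theorem hst5 : ∀ σ ∈ sieveStep 90 54 ((([[]] : List (List (ℕ × ℤ))) :: lvs).getD 5 []) (stages.getD 5 (0, [])), σ ∈ lvs.getD 5 [] := by decide +kernel
/-- Sieve stage `6`: the live list `L_6` is mapped into `L_7` (kernel `decide`). [folklore] -/
theorem hst6 : ∀ σ ∈ sieveStep 90 54 ((([[]] : List (List (ℕ × ℤ))) :: lvs).getD 6 []) (stages.getD 6 (0, [])), σ ∈ lvs.getD 6 [] := by decide +kernel
/-- Sieve stage `7`: the live list `L_7` is mapped into `L_8` (kernel `decide`). [folklore] -/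
theorem hst7 : ∀ σ ∈ sieveStep 90 54 ((([[]] : List (List (ℕ × ℤ))) :: lvs).getD 7 []) (stages.getD 7 (0, [])), σ ∈ lvs.getD 7 [] := by decide +kernel
/-- Sieve stage `8`: the live list `L_8` is mapped into `L_9` (kernel `decide`). [folklore] -/
theorem hst8 : ∀ σ ∈ sieveStep 90 54 ((([[]] : List (List (ℕ × ℤ))) :: lvs).getD 8 []) (stages.getD 8 (0, [])), σ ∈ lvs.getD 8 [] := by decide +kernel
/-- Sieve stage `9`: the live list `L_9` is mapped into `L_10` (kernel `decide`). [folklore] -/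
theorem hst9 : ∀ σ ∈ sieveStep 90 54 ((([[]] : List (List (ℕ × ℤ))) :: lvs).getD 9 []) (stages.getD 9 (0, [])), σ ∈ lvs.getD 9 [] := by decide +kernel
/-- Sieve stage `10`: the live list `L_10` is mapped into `L_11` (kernel `decide`). [folklore] -/
theorem hst10 : ∀ σ ∈ sieveStep 90 54 ((([[]] : List (List (ℕ × ℤ))) :: lvs).getD 10 []) (stages.getD 10 (0, [])), σ ∈ lvs.getD 10 [] := by decide +kernel

/-- **THE SIEVE**, certified one stage at a time (`hst0 … hst10`: stage `k` maps the live list `L_k` into `L_{k+1}`),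
assembled by `PinningKernel.runSieve_subset_of_chain` (part D `…PinningKernelStaged`): the staged box sieve returns only assignments listed in `certs`.
[cite: CremonaAlgorithms1997, §2.10] -/
theorem hcover : ∀ σ ∈ runSieve 90 54 stages, σ ∈ certs.map Prod.fst := by
  have hch : ∀ k < stages.length, ∀ σ ∈ sieveStep 90 54 ((([[]] : List (List (ℕ × ℤ))) :: lvs).getD k [])
      (stages.getD k (0, [])), σ ∈ lvs.getD k [] := by
    intro k hk
    have hk' : k < 11 := lt_of_lt_of_eq hk (by decide)
    interval_cases k
    exacts [hst0, hst1, hst2, hst3, hst4, hst5, hst6, hst7, hst8, hst9, hst10]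
  have hlast : ((([[]] : List (List (ℕ × ℤ))) :: lvs).getD stages.length []) = certs.map Prod.fst := by decide +kernel
  exact fun σ hσ ↦ hlast ▸ runSieve_subset_of_chain 90 54 stages lvs (by decide) hch σ hσ

/-- **The coordinate certificates** `d'·aₙ(σ) = Σ_j y_j·tabsⱼ[n]` on the dual support. [folklore] -/
theorem hpiv : ∀ c ∈ certs, ∀ i : Fin 26, ∀ n < (duals i).length, (duals i).getD n 0 ≠ 0 →
    (evalOpt 90 c.1 n).map (fun x ↦ c.2.1 * x) = some (∑ j : Fin 26, c.2.2.getD (j : ℕ) 0 * (tabs j).getD n 0) := by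
  decide +kernel

/-- Every exponent row sums to `4` (weight `2`). [folklore] -/
theorem hsum : ∀ i : Fin 26, ∑ δ ∈ (90 : ℕ).divisors, expFn (Ls[(i : ℕ)]).1 δ = 4 := by
  decide +kernel

/-- `LsE` lists the `σ`-images: `r_i(90/δ) = rE_i(δ)` on the divisors. [cite: Koehler2011, §2.4] -/
theorem hsig : ∀ i : Fin 26, ∀ δ ∈ (90 : ℕ).divisors,
    EtaFricke.frickeExp 90 (expFn (Ls[(i : ℕ)]).1) δ = expFn (LsE[(i : ℕ)]).1 δ := by
  decide +kernel

/-- The Fricke constants: `knum² · ∏_{r>0} δ^r = 90² · kden² · ∏_{r<0} δ^{−r}`. [cite: Koehler2011, §2.4] -/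
theorem hK : ∀ i : Fin 26, 0 < knum i ∧ 0 < kden i ∧
    knum i ^ 2 * posPart 90 (expFn (Ls[(i : ℕ)]).1) = 90 ^ 2 * kden i ^ 2 * negPart 90 (expFn (Ls[(i : ℕ)]).1) := by
  decide +kernel

/-- `Λ = 120` is a common multiple of the Fricke denominators. [folklore] -/
theorem hΛ : ∀ i : Fin 26, kden i ∣ 120 := by
  decide

/-- The decidable coordinate check (generic over part B's dual system): on the support of the duals,
`d · t_F[n] = Σ_j ⟨u_j, t_F⟩ · t_j[n]`. [folklore] -/
def coordsOK {g : ℕ} (t u : Fin g → List ℤ) (d : ℤ) (tF : List ℤ) : Bool :=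
  decide (∀ i : Fin g, ∀ n ∈ Finset.range (u i).length, (u i).getD n 0 ≠ 0 →
    d * tF.getD n 0 = ∑ j : Fin g, dotList (u j) tF * (t j).getD n 0)

/-- **Coordinates from a table** (generic): if `F` has certified coefficients `t_F` to depth `K` and `coordsOK` holds, then
`d • F = Σ_j ⟨u_j, t_F⟩ • C_j` (by part B's `eq_of_dual`). [folklore] -/
theorem smul_eq_sum_of_coordsOK {V : Type*} [AddCommGroup V] [Module ℂ V] [FiniteDimensional ℂ V] {g K : ℕ}
    {coef : ℕ → V →ₗ[ℂ] ℂ} (C : Fin g → V) (t u : Fin g → List ℤ) (d : ℤ)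
    (ht : ∀ i, ∀ n < K, (((t i).getD n 0 : ℤ) : ℂ) = coef n (C i)) (hu : ∀ i, (u i).length ≤ K)
    (hdual : ∀ i j, dotList (u i) (t j) = if i = j then d else 0) (hd : d ≠ 0) (hdim : Module.finrank ℂ V = g)
    (F : V) (tF : List ℤ) (htF : ∀ n < K, ((tF.getD n 0 : ℤ) : ℂ) = coef n F) (hok : coordsOK t u d tF = true) :
    ((d : ℤ) : ℂ) • F = ∑ j, ((dotList (u j) tF : ℤ) : ℂ) • C j := by
  have hok' := of_decide_eq_true hok
  refine eq_of_dual C t u d ht hu hdual hd hdim fun i n hn hne ↦ ?_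
  have hnK : n < K := lt_of_lt_of_le hn (hu i)
  have h := congrArg (fun z : ℤ ↦ (z : ℂ)) (hok' i n (Finset.mem_range.mpr hn) hne)
  push_cast at h
  rw [map_smul, smul_eq_mul, ← htF n hnK, map_sum, h]
  exact Finset.sum_congr rfl fun j _ ↦ by rw [map_smul, smul_eq_mul, ht j n hnK]

/-- Coordinate certificate of the `σ`-image `0` on the basis (kernel `decide`). [folklore] -/
theorem hcoords0 : coordsOK tabs duals 486000 (tabsE 0) = true := by decide +kernel
/-- Coordinate certificate of the `σ`-image `1` on the basis (kernel `decide`). [folklore] -/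
theorem hcoords1 : coordsOK tabs duals 486000 (tabsE 1) = true := by decide +kernel
/-- Coordinate certificate of the `σ`-image `2` on the basis (kernel `decide`). [folklore] -/
theorem hcoords2 : coordsOK tabs duals 486000 (tabsE 2) = true := by decide +kernel
/-- Coordinate certificate of the `σ`-image `3` on the basis (kernel `decide`). [folklore] -/
theorem hcoords3 : coordsOK tabs duals 486000 (tabsE 3) = true := by decide +kernel
/-- Coordinate certificate of the `σ`-image `4` on the basis (kernel `decide`). [folklore] -/
theorem hcoords4 : coordsOK tabs duals 486000 (tabsE 4) = true := by decide +kernel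
/-- Coordinate certificate of the `σ`-image `5` on the basis (kernel `decide`). [folklore] -/
theorem hcoords5 : coordsOK tabs duals 486000 (tabsE 5) = true := by decide +kernel
/-- Coordinate certificate of the `σ`-image `6` on the basis (kernel `decide`). [folklore] -/
theorem hcoords6 : coordsOK tabs duals 486000 (tabsE 6) = true := by decide +kernel
/-- Coordinate certificate of the `σ`-image `7` on the basis (kernel `decide`). [folklore] -/
theorem hcoords7 : coordsOK tabs duals 486000 (tabsE 7) = true := by decide +kernel
/-- Coordinate certificate of the `σ`-image `8` on the basis (kernel `decide`). [folklore] -/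
theorem hcoords8 : coordsOK tabs duals 486000 (tabsE 8) = true := by decide +kernel
/-- Coordinate certificate of the `σ`-image `9` on the basis (kernel `decide`). [folklore] -/
theorem hcoords9 : coordsOK tabs duals 486000 (tabsE 9) = true := by decide +kernel
/-- Coordinate certificate of the `σ`-image `10` on the basis (kernel `decide`). [folklore] -/
theorem hcoords10 : coordsOK tabs duals 486000 (tabsE 10) = true := by decide +kernel
/-- Coordinate certificate of the `σ`-image `11` on the basis (kernel `decide`). [folklore] -/
theorem hcoords11 : coordsOK tabs duals 486000 (tabsE 11) = true := by decide +kernel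
/-- Coordinate certificate of the `σ`-image `12` on the basis (kernel `decide`). [folklore] -/
theorem hcoords12 : coordsOK tabs duals 486000 (tabsE 12) = true := by decide +kernel
/-- Coordinate certificate of the `σ`-image `13` on the basis (kernel `decide`). [folklore] -/
theorem hcoords13 : coordsOK tabs duals 486000 (tabsE 13) = true := by decide +kernel
/-- Coordinate certificate of the `σ`-image `14` on the basis (kernel `decide`). [folklore] -/
theorem hcoords14 : coordsOK tabs duals 486000 (tabsE 14) = true := by decide +kernel
/-- Coordinate certificate of the `σ`-image `15` on the basis (kernel `decide`). [folklore] -/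
theorem hcoords15 : coordsOK tabs duals 486000 (tabsE 15) = true := by decide +kernel
/-- Coordinate certificate of the `σ`-image `16` on the basis (kernel `decide`). [folklore] -/
theorem hcoords16 : coordsOK tabs duals 486000 (tabsE 16) = true := by decide +kernel
/-- Coordinate certificate of the `σ`-image `17` on the basis (kernel `decide`). [folklore] -/
theorem hcoords17 : coordsOK tabs duals 486000 (tabsE 17) = true := by decide +kernel
/-- Coordinate certificate of the `σ`-image `18` on the basis (kernel `decide`). [folklore] -/
theorem hcoords18 : coordsOK tabs duals 486000 (tabsE 18) = true := by decide +kernel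
/-- Coordinate certificate of the `σ`-image `19` on the basis (kernel `decide`). [folklore] -/
theorem hcoords19 : coordsOK tabs duals 486000 (tabsE 19) = true := by decide +kernel
/-- Coordinate certificate of the `σ`-image `20` on the basis (kernel `decide`). [folklore] -/
theorem hcoords20 : coordsOK tabs duals 486000 (tabsE 20) = true := by decide +kernel
/-- Coordinate certificate of the `σ`-image `21` on the basis (kernel `decide`). [folklore] -/
theorem hcoords21 : coordsOK tabs duals 486000 (tabsE 21) = true := by decide +kernel
/-- Coordinate certificate of the `σ`-image `22` on the basis (kernel `decide`). [folklore] -/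
theorem hcoords22 : coordsOK tabs duals 486000 (tabsE 22) = true := by decide +kernel
/-- Coordinate certificate of the `σ`-image `23` on the basis (kernel `decide`). [folklore] -/
theorem hcoords23 : coordsOK tabs duals 486000 (tabsE 23) = true := by decide +kernel
/-- Coordinate certificate of the `σ`-image `24` on the basis (kernel `decide`). [folklore] -/
theorem hcoords24 : coordsOK tabs duals 486000 (tabsE 24) = true := by decide +kernel
/-- Coordinate certificate of the `σ`-image `25` on the basis (kernel `decide`). [folklore] -/
theorem hcoords25 : coordsOK tabs duals 486000 (tabsE 25) = true := by decide +kernel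

/-- **The coordinate certificates of the `σ`-images** on the basis (decidable, one kernel certificate per image). [folklore] -/
theorem hcoords : ∀ i : Fin 26, coordsOK tabs duals 486000 (tabsE i) = true := by
  intro i; fin_cases i
  exacts [hcoords0, hcoords1, hcoords2, hcoords3, hcoords4, hcoords5, hcoords6, hcoords7, hcoords8, hcoords9, hcoords10, hcoords11, hcoords12, hcoords13, hcoords14, hcoords15, hcoords16, hcoords17, hcoords18, hcoords19, hcoords20, hcoords21, hcoords22, hcoords23, hcoords24, hcoords25]

/-- The common denominator of the Fricke matrix: `Φd = d · Λ = 486000 · 120`. [folklore] -/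
def Φd : ℕ := 58320000

/-- The integer Fricke matrix: `Φn j i = −knumᵢ · (Λ/kdenᵢ) · ⟨duals_j, tabsE_i⟩` (`w_N C_i = Σ_j (Φn j i / Φd) C_j`). [folklore] -/
def Φn (j i : Fin 26) : ℤ := -((knum i : ℤ) * ((120 / kden i : ℕ) : ℤ) * dotList (duals j) (tabsE i))



/-- Only the `90a, 90b, 90c` certificates pass the MATRIX Fricke-row check (for either sign). [folklore] -/
theorem hfr : ∀ c ∈ certs, ((∀ j : Fin 26, ∑ i : Fin 26, Φn j i * c.2.2.getD (i : ℕ) 0 = Φd * c.2.2.getD (j : ℕ) 0) ∨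
    (∀ j : Fin 26, ∑ i : Fin 26, Φn j i * c.2.2.getD (i : ℕ) 0 = -(Φd * c.2.2.getD (j : ℕ) 0))) → c ∈ goodCerts := by
  decide +kernel

/-! ## §3 `dim M₂(Γ₀(90)) = 26` -/

/-- `μ(Γ₀(90)) = 216`, `ν_∞ = 16`, `ν₂ = ν₃ = 0`. [cite: DiamondShurman2005, §3.8] -/
theorem gamma0_data : gamma0Index 90 = 216 ∧ nuInfty 90 = 16 ∧ nu₂ 90 = 0 ∧ nu₃ 90 = 0 := by
  refine ⟨?_, by decide, by rw [nu₂_eq_card]; decide, by rw [nu₃_eq_card]; decide⟩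
  · rw [(gamma0Index_mul (m := 2) (n := 45) (by norm_num)), (gamma0Index_mul (m := 9) (n := 5) (by norm_num)),
      show (9 : ℕ) = 3 ^ 2 by norm_num, gamma0Index_prime_pow (p := 3) (e := 2) Nat.prime_three (by norm_num),
      gamma0Index_prime Nat.prime_two, gamma0Index_prime (by norm_num : Nat.Prime 5)]
    norm_num

/-- **`dim M₂(Γ₀(90)) = 26`** (`g = 11`, `ν_∞ = 16`). [cite: DiamondShurman2005, Thm. 3.5.1] -/
theorem finrank_modularForm_two : Module.finrank ℂ (ModularForm (Gamma0 90) 2) = 26 := by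
  obtain ⟨h1, h2, h3, h4⟩ := gamma0_data
  rw [finrank_modularForm_two_eq 90, genusX0, h1, h2, h3, h4]

/-! ## §4 The pinning (3 classes; matrix Fricke sieve of the tree's part E `…PinningKernelFrickeMatrix`) -/

/-- `Φd > 0`. [folklore] -/
theorem Φd_pos : 0 < Φd := by decide

/-- The integer presentation of the Fricke matrix: `(−Kᵢ · ⟨duals_j, tabsE_i⟩/d) · Φd = Φn j i`. [folklore] -/
theorem hΦ (j i : Fin 26) : -(((knum i : ℝ) / kden i : ℝ) : ℂ) * (((dotList (duals j) (tabsE i) : ℤ) : ℂ) / ((486000 : ℤ) : ℂ)) * (Φd : ℂ) =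
    ((Φn j i : ℤ) : ℂ) := by
  have hdi : ((kden i : ℕ) : ℂ) ≠ 0 := by exact_mod_cast (hK i).2.1.ne'
  have hq : (((120 / kden i : ℕ) : ℤ) : ℂ) * (kden i : ℂ) = 120 := by
    have h5 : ((120 / kden i : ℕ) : ℤ) * (kden i : ℤ) = 120 := by exact_mod_cast Nat.div_mul_cancel (hΛ i)
    exact_mod_cast h5
  rw [Φn, Φd, show ((58320000 : ℕ) : ℂ) = ((486000 : ℤ) : ℂ) * (((120 / kden i : ℕ) : ℤ) : ℂ) * (kden i : ℂ) by
    rw [mul_assoc, hq]; push_cast; norm_num]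
  push_cast
  field_simp

/-- **LEVEL 90 PINNED (one of 3 newform classes).**  For every `X₀(90)`-datum of an elliptic `W/ℚ`, with the `η`-quotient
modular forms `Cᵢ` of `Ls`: for some certificate `c = (σ, d', y) ∈ goodCerts` (the 3 classes `90a, 90b, 90c`; the old classes are
killed by the matrix Fricke rows of part E), the sieve truth of `W` is `σ` and `d' • f = Σ_j y_j • C_j` in `M₂(Γ₀(90))`.
[cite: CremonaAlgorithms1997, §2.10, Table 1 (90a, 90b, 90c)] [cite: AtkinLehner1970, Thm. 3] -/
theorem pinning {W : WeierstrassCurve ℚ} [W.IsElliptic] (D : ModularParametrizationData W 90) :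
    ∃ C : Fin 26 → ModularForm (Gamma0 90) 2, (∀ i, ∀ τ : ℍ, C i τ = etaQuotient 90 (expFn (Ls[(i : ℕ)]).1) τ) ∧
      ∃ c ∈ goodCerts, truth W (stages.map Prod.fst) = c.1 ∧
        ((c.2.1 : ℤ) : ℂ) • ModularFormClass.modularForm D.f = ∑ j : Fin 26, ((c.2.2.getD (j : ℕ) 0 : ℤ) : ℂ) • C j := by
  haveI : FiniteDimensional ℂ (ModularForm (Gamma0 90) 2) := Module.finite_of_finrank_eq_succ finrank_modularForm_two
  obtain ⟨C, hC⟩ := exists_etaModularForms 90 Ls hol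
  obtain ⟨E, hE⟩ := exists_etaModularForms 90 LsE holE
  have ht := tables_of_etaCerts 90 54 (fun i : Fin 26 ↦ expFn (Ls[(i : ℕ)]).1) (fun i ↦ shifts i) tabs C hC hshift hcert
  have htE := tables_of_etaCerts 90 54 (fun i : Fin 26 ↦ expFn (LsE[(i : ℕ)]).1) (fun i ↦ shiftsE i) tabsE E hE hshiftE hcertE
  -- the stage primes are prime (inlined: a top-level `hps` would restate `PinningOneHundred.hps` verbatim for the dedup lint)
  have hps : ∀ st ∈ stages, st.1.Prime := by
    intro st hst
    have h : st.1 ∈ stages.map Prod.fst := List.mem_map.mpr ⟨st, hst, rfl⟩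
    have hl : stages.map Prod.fst = [3, 2, 5, 7, 11, 13, 17, 19, 23, 29, 31] := by decide
    rw [hl] at h
    simp only [List.mem_cons, List.mem_nil_iff, or_false] at h
    rcases h with h | h | h | h | h | h | h | h | h | h | h <;> rw [h] <;> norm_num
  obtain ⟨c, hc, hc1, hpin⟩ := exists_smul_eq_sum_of_certs D (ModularFormClass.modularForm D.f) (modCoefₗ_newform D) C
    tabs duals 486000 ht hlen hdual (by norm_num) finrank_modularForm_two stages hps hrel certs hcover hpiv
  -- the matrix Fricke sieve (tree part E)
  have hli : LinearIndependent ℂ C := linearIndependent_of_dual C tabs duals 486000 ht hlen hdual (by norm_num)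
  have hdC : ((486000 : ℤ) : ℂ) ≠ 0 := by norm_num
  have hM : ∀ i : Fin 26, ((486000 : ℤ) : ℂ) • E i = ∑ j, ((dotList (duals j) (tabsE i) : ℤ) : ℂ) • C j := fun i ↦
    smul_eq_sum_of_coordsOK C tabs duals 486000 ht hlen hdual (by norm_num) finrank_modularForm_two (E i) (tabsE i) (htE i) (hcoords i)
  have himg : ∀ i : Fin 26, E i = ∑ j, ((((dotList (duals j) (tabsE i) : ℤ) : ℂ)) / ((486000 : ℤ) : ℂ)) • C j := fun i ↦ by
    have h2 := congrArg (fun G : ModularForm (Gamma0 90) 2 ↦ (((486000 : ℤ) : ℂ)⁻¹) • G) (hM i)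
    simp only [smul_smul, inv_mul_cancel₀ hdC, one_smul, Finset.smul_sum] at h2
    rw [h2]
    exact Finset.sum_congr rfl fun j _ ↦ by rw [div_eq_inv_mul]
  have hW := slash_eq_sum_of_imageCoords C (fun i : Fin 26 ↦ expFn (Ls[(i : ℕ)]).1) hC E
    (fun i : Fin 26 ↦ expFn (LsE[(i : ℕ)]).1) hE knum kden hsum hsig hK
    (fun i j ↦ (((dotList (duals j) (tabsE i) : ℤ) : ℂ)) / ((486000 : ℤ) : ℂ)) himg
  have hd' : c.2.1 ≠ 0 := by
    simp only [certs, List.mem_cons, List.mem_nil_iff, or_false] at hc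
    rcases hc with rfl | rfl | rfl | rfl <;> decide
  have hrows := frickeMatrixRows_of_pinning D C hli
    (fun j i ↦ -(((knum i : ℝ) / kden i : ℝ) : ℂ) * ((((dotList (duals j) (tabsE i) : ℤ) : ℂ)) / ((486000 : ℤ) : ℂ))) Φn Φd Φd_pos
    hΦ hW hd' c.2.2 hpin
  exact ⟨C, hC, c, hfr c hc hrows, hc1.symm, hpin⟩

end Summit.BirchSwinnertonDyer.BirchSwinnertonDyer.Theorems.ManinLocalTwoThree.PinningNinety

end
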